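import Summits.KontsevichZagierPeriods.KontsevichZagierPeriods.Theorems.UnfoldedStokesStokesGenerationFibrewiseRungTrilogLeftovers
import Summits.KontsevichZagierPeriods.KontsevichZagierPeriods.Theorems.UnfoldedStokesStokesGenerationFibrewiseClosureSum
import Summits.KontsevichZagierPeriods.KontsevichZagierPeriods.Theorems.UnfoldedStokesStokesGenerationFibrewiseClosureSmul
import Summits.KontsevichZagierPeriods.KontsevichZagierPeriods.Theorems.UnfoldedStokesStokesGenerationFibrewiseRungAngSwap

/-!
# `StokesGeneration` (stmt-KontsevichZagierPeriods-3586), line `fibrewise_stokes` — rung 26: THE TRILOGARITHM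

Crux `Summit.KontsevichZagierPeriods.KontsevichZagierPeriods.Theses.UnfoldedStokes.StokesGeneration`; residual stub S2
(`FibStokesDecomposable`, `Theorems/UnfoldedStokesDefs.lean`). For real algebraic `0 < x₁, x₂ < 1` the difference of the
bounded cube integrands on `[0,1]³` of `G(x₂)` and `G(x₁)`,
`G(x) = Li₃(x) + Li₃(1−x) + Li₃(−x/(1−x)) − log(1−x)(Li₂(x) + Li₂(1−x)) − ½log x log²(1−x) − ⅙log³(1−x)` (`= ζ(3)`), is
fibrewise-Stokes decomposable (`fibStokesDecomposable_trilogLanden_sub`): the homotopy `x(v) = x₁ + (x₂−x₁)v` (part A, seven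
homotopy certificates of rung 24) leaves `x′/(x(1−x))·Λ_{x(v)}` up to transpositions (part B), and Landen's identity with a
parameter (rung 25) kills it. The first weight-THREE functional equation in S2's economy — obtained by feeding the derivative
of the identity back one weight down, i.e. the induction on the weight; the anchor `ζ(3)` itself is not claimed.

References: L. Lewin, *Polylogarithms and associated functions* (1981), (6.10); D. Zagier, *The dilogarithm function* (2007), §I.2;
M. Kontsevich, D. Zagier, *Periods* (2001), §1.2.
-/

noncomputable section

-- `Summit.KontsevichZagierPeriods.KontsevichZagierPeriods.…` is the tree's mandated layout (single-conjunct summit).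
set_option linter.dupNamespace false

namespace Summit.KontsevichZagierPeriods.KontsevichZagierPeriods.Cruxes.StokesGeneration.FibrewiseStokes

open MeasureTheory Set
open Literature.NumberTheory.Transcendental
open Literature.NumberTheory.Transcendental.KZ
open Literature.ModelTheory.ExponentialFields (IsSemialgebraic)

/-! ## Part C — the assembly -/

/-- The `Li₃(−y/(1−y))` cube integrand in lowest terms. [folklore] -/
theorem trilog_w3_form {y p : ℝ} (hy : 1 - y ≠ 0) :
    -y / (1 - y) / (1 - -y / (1 - y) * p) = -y / (1 - y + y * p) := by
  have e : 1 - -y / (1 - y) * p = (1 - y + y * p) / (1 - y) := by field_simp; ring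
  rw [e, div_div_div_cancel_right₀ hy]

/-- **Rung 26 (lead c6): the trilogarithm combination is constant modulo Dec.** For real algebraic `0 < x₁, x₂ < 1`, the
difference of the cube integrands on `[0,1]³` of `G(x₂)` and `G(x₁)`, where
`G(x) = Li₃(x) + Li₃(1−x) + Li₃(−x/(1−x)) − log(1−x)(Li₂(x) + Li₂(1−x)) − ½log x log²(1−x) − ⅙log³(1−x)` (`= ζ(3)`, Landen's
trilogarithm identity with Euler's `π²/6 = Li₂(x) + Li₂(1−x) + log x log(1−x)` substituted; `Li₃(w) ↦ w/(1−wstu)`,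
`Li₂(w) ↦ w/(1−wst)`, `log(1−x) ↦ ∫₀¹ −x/(1−xu) du`, `log x ↦ ∫₀¹ −(1−x)/(1−(1−x)s) ds`), is fibrewise-Stokes decomposable: the
homotopy `x(v) = x₁ + (x₂−x₁)v` (A1–A7) leaves `γ(v)·Λ_{x(v)}` up to transpositions (B2), and Landen with a parameter (rung 25)
kills it. The first weight-THREE functional equation in S2's economy; transcendence-free and value-free (the anchor `ζ(3)` is
not claimed). [cite: Zagier2007Dilogarithm, §I.2] -/
theorem fibStokesDecomposable_trilogLanden_sub (x₁ x₂ : ℝ) (h₁ : IsAlgebraic ℚ x₁) (h₂ : IsAlgebraic ℚ x₂)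
    (h₁0 : 0 < x₁) (h₁1 : x₁ < 1) (h₂0 : 0 < x₂) (h₂1 : x₂ < 1) :
    FibStokesDecomposable 3 (fun z =>
      (x₂ / (1 - x₂ * z 0 * z 1 * z 2) + (1 - x₂) / (1 - (1 - x₂) * z 0 * z 1 * z 2) +
            (-x₂) / (1 - x₂ + x₂ * z 0 * z 1 * z 2) -
          (-x₂ / (1 - x₂ * z 2)) * (x₂ / (1 - x₂ * z 0 * z 1)) -
          (-x₂ / (1 - x₂ * z 2)) * ((1 - x₂) / (1 - (1 - x₂) * z 0 * z 1)) -
          (1 / 2) * ((-(1 - x₂) / (1 - (1 - x₂) * z 0)) * (-x₂ / (1 - x₂ * z 1)) * (-x₂ / (1 - x₂ * z 2))) -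
          (1 / 6) * ((-x₂ / (1 - x₂ * z 0)) * (-x₂ / (1 - x₂ * z 1)) * (-x₂ / (1 - x₂ * z 2)))) -
      (x₁ / (1 - x₁ * z 0 * z 1 * z 2) + (1 - x₁) / (1 - (1 - x₁) * z 0 * z 1 * z 2) +
            (-x₁) / (1 - x₁ + x₁ * z 0 * z 1 * z 2) -
          (-x₁ / (1 - x₁ * z 2)) * (x₁ / (1 - x₁ * z 0 * z 1)) -
          (-x₁ / (1 - x₁ * z 2)) * ((1 - x₁) / (1 - (1 - x₁) * z 0 * z 1)) -
          (1 / 2) * ((-(1 - x₁) / (1 - (1 - x₁) * z 0)) * (-x₁ / (1 - x₁ * z 1)) * (-x₁ / (1 - x₁ * z 2))) -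
          (1 / 6) * ((-x₁ / (1 - x₁ * z 0)) * (-x₁ / (1 - x₁ * z 1)) * (-x₁ / (1 - x₁ * z 2))))) := by
  have C1 := trilog_termLi3 x₁ x₂ h₁ h₂ h₁0 h₁1 h₂0 h₂1
  have C2 := trilog_termLi3' x₁ x₂ h₁ h₂ h₁0 h₁1 h₂0 h₂1
  have C3 := trilog_termLi3w x₁ x₂ h₁ h₂ h₁0 h₁1 h₂0 h₂1
  have C4 := trilog_termLogLi2 x₁ x₂ h₁ h₂ h₁0 h₁1 h₂0 h₂1 1 0 (Or.inl ⟨rfl, rfl⟩)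
  have C5 := trilog_termLogLi2 x₁ x₂ h₁ h₂ h₁0 h₁1 h₂0 h₂1 (-1) 1 (Or.inr ⟨rfl, rfl⟩)
  have C6 := trilog_termLogs x₁ x₂ h₁ h₂ h₁0 h₁1 h₂0 h₂1 (-1) 1 (Or.inr ⟨rfl, rfl⟩)
  have C7 := trilog_termLogs x₁ x₂ h₁ h₂ h₁0 h₁1 h₂0 h₂1 1 0 (Or.inl ⟨rfl, rfl⟩)
  have HL := trilog_leftovers x₁ x₂ h₁ h₂ h₁0 h₁1 h₂0 h₂1
  have hhalf : IsAlgebraic ℚ ((1:ℝ) / 2) := by simpa using isAlgebraic_algebraMap (R := ℚ) (A := ℝ) (1 / 2)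
  have hsixth : IsAlgebraic ℚ ((1:ℝ) / 6) := by simpa using isAlgebraic_algebraMap (R := ℚ) (A := ℝ) (1 / 6)
  have C6' := fibStokesDecomposable_const_mul 4 _ _ hhalf C6
  have C7' := fibStokesDecomposable_const_mul 4 _ _ hsixth C7
  have hsum := fibStokesDecomposable_sub 4 _ _ (fibStokesDecomposable_sub 4 _ _ (fibStokesDecomposable_sub 4 _ _
    (fibStokesDecomposable_sub 4 _ _ (fibStokesDecomposable_add 4 _ _ (fibStokesDecomposable_add 4 _ _ C1 C2) C3) C4) C5)
    C6') C7'
  have hS := fibStokesDecomposable_sub 4 _ _ HL hsum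
  have hle : 3 ≤ 4 := by norm_num
  refine fibStokesDecomposable_unpad hle _ (fibStokesDecomposable_congr_off_null 4 _ _ ∅
    Literature.ModelTheory.ExponentialFields.isSemialgebraic_empty measure_empty (fun z hz _ => ?_) hS)
  have e0 : z (Fin.castLE hle 0) = z 0 := rfl
  have e1 : z (Fin.castLE hle 1) = z 1 := rfl
  have e2 : z (Fin.castLE hle 2) = z 2 := rfl
  have e5' : ∀ y : ℝ, 1 + -y = 1 - y := fun y => by ring
  have e6 : x₁ + (x₂ - x₁) = x₂ := by ring
  simp only [e0, e1, e2, mul_one, mul_zero, add_zero, one_mul, zero_add, neg_neg, neg_mul, e5', e6]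
  have hy2 : 1 - x₂ ≠ 0 := by linarith
  have hy1 : 1 - x₁ ≠ 0 := by linarith
  rw [mul_assoc (-x₂ / (1 - x₂)) (z 0) (z 1), mul_assoc (-x₂ / (1 - x₂)) (z 0 * z 1) (z 2),
    trilog_w3_form (p := z 0 * z 1 * z 2) hy2,
    mul_assoc (-x₁ / (1 - x₁)) (z 0) (z 1), mul_assoc (-x₁ / (1 - x₁)) (z 0 * z 1) (z 2),
    trilog_w3_form (p := z 0 * z 1 * z 2) hy1]
  ring


end Summit.KontsevichZagierPeriods.KontsevichZagierPeriods.Cruxes.StokesGeneration.FibrewiseStokes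

end
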